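/-
Copyright (c) 2026. All rights reserved.
Released under Apache 2.0 license as described in the file LICENSE.
Authors: abc-iut cell, prover seat abc-iut-w5-d097 (wave 5), over the statements of abc-iut-L4-t3.
-/
import Literature.AnabelianGeometry.AbsoluteAnabelian.LogFrobeniusObservablesTelecore
import HarnessLib

/-!
# [AbsTopIII] Corollary 5.5 (iii), `TS`-half: the coherence law carried by the observable `S_log`

S. Mochizuki, *Topics in absolute anabelian geometry III: global reconstruction algorithms*,
J. Math. Sci. Univ. Tokyo 22 (2015) 939–1156 [MochizukiAbsTopIII2015]; locators = pages of the author's manuscript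
(`paper:url-5493eb38cbb7`): Cor 5.5 (iii) p. 131 ("respectively, `ι_{v,ε}` … a structure of observable `S_log` on the
portion of `D•_{≤3}` indexed by `v`"), Def 3.5 (ii) p. 75 (a family of homotopies assigns ONE homotopy `ζ_ϖ` to each pair
`ϖ` of its boundary set, with `ζ_{ϖ''} = ζ_{ϖ'} ∘ ζ_ϖ`), Def 5.4 (iii) p. 126 (the nonarchimedean graph `Γ⃗^log_non` —
"a commutative diagram" — with the two routes `𝒪^×_k̄ ↪ k̄^× → (k̄^×)^pf` and `𝒪^×_k̄ →(log) k~ ↪ (k̄^×)^pf`), (vii) p. 128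
(the `TS`-valued `ι_{v,ε}` for EVERY edge of `Γ⃗^log_v`).

Proof-only companion (no new notion, no named `Prop`) of abc-iut-L4-t3's `LogFrobeniusObservables.lean`
(`Cor55ObservablesTS` = FACT-LIST F-3080, `Cor55ObservablesCompatible` = F-3081) and `LogFrobeniusObservablesTelecore.lean`
(`Cor55ObservablesTelecoreCompatible` = F-3757); cone node AbsTopIII:Cor5.5(iii).  The `⊞`-half — the law that
`Cor55Observables` (F-0142) forces on the `ι⊞_{v,ε}`, together with the refutation of its universal closure — is
abc-iut-f-101's `LogFrobeniusObservablesIotaSquare.lean` (p428576; `iota_comp_eq_of_isLogObservablePlus`,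
`not_forall_cor55Observables`); this file is the `TS` analogue for the observable `S_log` on `𝒩_v` and nothing of that
file is restated: every family `H` with the typed property `IsLogObservableTS T v H` assigns one homotopy to the pair
(`[λ_{v,νa}]`, `[λ_{v,νd}]`), so for every DIAMOND of edges `νa → νb → νd`, `νa → νc → νd` of `Γ⃗^log_v` among pre-log
vertices the `TS`-valued `ι_{v,ε}` of Def 5.4 (vii) satisfy `ι_{ε₁} ≫ ι_{ε₂} = ι_{ε₃} ≫ ι_{ε₄}` componentwise
(`TSHomotopies.iota_diamond_of_isLogObservableTS`, with the one cast `λ_{νb} = Λ_{νb} ∘ λ_{νb}` made explicit).  At a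
NONARCHIMEDEAN place `Γ⃗^log_non` has such a diamond (`exists_diamondTS_of_eq_false`).  Consequences for the three
typed statements: `cor55ObservablesTS_diamond`, `cor55ObservablesCompatible_diamond`,
`cor55ObservablesTelecoreCompatible_diamond`, and the criterion `not_cor55ObservablesTS_of_diamond_ne` — F-3080 /
F-3081 / F-3757 are genuine laws on the datum `T : TSHomotopies` (the commutativity of Def 5.4 (iii)'s diagram pushed
down to `𝒩_v`), not consequences of the typing.  Refereed pre-IUT material; OUR kernel check of typed statements;
nothing here bears on [IUTchIII] Cor. 3.12; no side taken.
-/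

set_option autoImplicit false

universe u

open CategoryTheory Quiver

namespace Literature.AnabelianGeometry.AbsoluteAnabelian

namespace LogFrobeniusSetting

variable {Vmod : Type u} {isArc : Vmod → Bool} (L : LogFrobeniusSetting Vmod isArc)

/-- For a pre-log vertex `ν`, `Λ_ν = 𝟭` (Def 5.4 (vii)), so `(Λ_ν ∘ λ_{v,ν})(x) = λ_{v,ν}(x)` on `𝒩_v` — the cast needed to
compose `ι_{ε₁} : Λ_{νa} ∘ λ_{νa} → λ_{νb}` with `ι_{ε₂} : Λ_{νb} ∘ λ_{νb} → λ_{νd}`.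
[cite: MochizukiAbsTopIII2015, Def 5.4 (vii) p. 128] -/
theorem lam_forget_obj_eq_twist_obj (v : Vmod) {ν : LogVertex (isArc v)} (hν : ν.isPostLog = false) (X₀ : L.X) :
    (L.lam v ν ⋙ L.forget v).obj X₀ = ((frobeniusTwist L.log ν.isPostLog ⋙ L.lam v ν) ⋙ L.forget v).obj X₀ := by
  rw [hν]
  rfl

/-- Cancelling `eqToHom` book-ends and merging the middle casts in an identity between two three-fold composites
(the shape "pin ≫ pin = pin ≫ pin" produced by Def 3.5 (ii)). [folklore] -/
private theorem diamond_of_conj {C : Type*} [Category C] {s s' B Pb Sb Cc Pc Sc d d' : C}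
    (o₁ : s' = s) (o₁' : B = Pb) (o₂ : Pb = Sb) (o₂' : d = d') (o₃ : s' = s) (o₃' : Cc = Pc) (o₄ : Pc = Sc)
    (o₄' : d = d') {ι₁ : s ⟶ B} {ι₂ : Sb ⟶ d} {ι₃ : s ⟶ Cc} {ι₄ : Sc ⟶ d}
    (h : (eqToHom o₁ ≫ ι₁ ≫ eqToHom o₁') ≫ (eqToHom o₂ ≫ ι₂ ≫ eqToHom o₂') =
      (eqToHom o₃ ≫ ι₃ ≫ eqToHom o₃') ≫ (eqToHom o₄ ≫ ι₄ ≫ eqToHom o₄')) :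
    ι₁ ≫ eqToHom (o₁'.trans o₂) ≫ ι₂ = ι₃ ≫ eqToHom (o₃'.trans o₄) ≫ ι₄ := by
  subst o₁ o₁' o₂ o₂' o₃' o₄
  simpa using h

/-! ## `S_log`: the diamond law for the `TS`-valued `ι_{v,ε}` -/

namespace TSHomotopies

variable {L} (T : L.TSHomotopies)

/-- **The coherence law carried by an observable `S_log`** (`TS`-half of Cor 5.5 (iii)): if `H` has the typed property
`IsLogObservableTS T v H`, then for every diamond of edges of `Γ⃗^log_v` among pre-log vertices
`ι_{ε₁} ≫ ι_{ε₂} = ι_{ε₃} ≫ ι_{ε₄}` componentwise (on `𝒩_v`). [cite: MochizukiAbsTopIII2015, Cor 5.5 (iii) p. 131] -/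
theorem iota_diamond_of_isLogObservableTS (v : Vmod) {H : (L.logDiagramTS v).HomotopyFamily}
    (hH : L.IsLogObservableTS T v H) {νa νb νc νd : LogVertex (isArc v)} (ha : νa.isPostLog = false)
    (hb : νb.isPostLog = false) (hc : νc.isPostLog = false) (hd : νd.isPostLog = false)
    (ε₁ : LogEdgeTS (isArc v) νa νb) (ε₂ : LogEdgeTS (isArc v) νb νd) (ε₃ : LogEdgeTS (isArc v) νa νc)
    (ε₄ : LogEdgeTS (isArc v) νc νd) (X₀ : L.X) :
    (T.iota v ε₁).app X₀ ≫ eqToHom (L.lam_forget_obj_eq_twist_obj v hb X₀) ≫ (T.iota v ε₂).app X₀ =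
      (T.iota v ε₃).app X₀ ≫ eqToHom (L.lam_forget_obj_eq_twist_obj v hc X₀) ≫ (T.iota v ε₄).app X₀ := by
  obtain ⟨-, hpre, -⟩ := hH
  obtain ⟨h₁, p₁⟩ := hpre νa νb ε₁ ha hb
  obtain ⟨h₂, p₂⟩ := hpre νb νd ε₂ hb hd
  obtain ⟨h₃, p₃⟩ := hpre νa νc ε₃ ha hc
  obtain ⟨h₄, p₄⟩ := hpre νc νd ε₄ hc hd
  have key : H.η h₁ ≫ H.η h₂ = H.η h₃ ≫ H.η h₄ := by
    rw [← H.η_trans h₁ h₂, ← H.η_trans h₃ h₄]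
  have keyx : (H.η h₁).app X₀ ≫ (H.η h₂).app X₀ = (H.η h₃).app X₀ ≫ (H.η h₄).app X₀ := by
    simpa only [NatTrans.comp_app] using NatTrans.congr_app key X₀
  obtain ⟨o₁, o₁', e₁⟩ := p₁ X₀
  obtain ⟨o₂, o₂', e₂⟩ := p₂ X₀
  obtain ⟨o₃, o₃', e₃⟩ := p₃ X₀
  obtain ⟨o₄, o₄', e₄⟩ := p₄ X₀
  rw [e₁, e₂, e₃, e₄] at keyx
  exact diamond_of_conj o₁ o₁' o₂ o₂' o₃ o₃' o₄ o₄' keyx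

end TSHomotopies

/-- **`Cor55ObservablesTS` carries the diamond law** for the `TS`-valued `ι_{v,ε}` of Def 5.4 (vii).
[cite: MochizukiAbsTopIII2015, Cor 5.5 (iii) p. 131] -/
theorem cor55ObservablesTS_diamond (T : L.TSHomotopies) (h : L.Cor55ObservablesTS T) (v : Vmod)
    {νa νb νc νd : LogVertex (isArc v)} (ha : νa.isPostLog = false) (hb : νb.isPostLog = false)
    (hc : νc.isPostLog = false) (hd : νd.isPostLog = false) (ε₁ : LogEdgeTS (isArc v) νa νb)
    (ε₂ : LogEdgeTS (isArc v) νb νd) (ε₃ : LogEdgeTS (isArc v) νa νc) (ε₄ : LogEdgeTS (isArc v) νc νd) (X₀ : L.X) :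
    (T.iota v ε₁).app X₀ ≫ eqToHom (L.lam_forget_obj_eq_twist_obj v hb X₀) ≫ (T.iota v ε₂).app X₀ =
      (T.iota v ε₃).app X₀ ≫ eqToHom (L.lam_forget_obj_eq_twist_obj v hc X₀) ≫ (T.iota v ε₄).app X₀ := by
  obtain ⟨H, hH⟩ := h v
  exact T.iota_diamond_of_isLogObservableTS v hH ha hb hc hd ε₁ ε₂ ε₃ ε₄ X₀

/-- The `TS`-diamond law under `Cor55ObservablesCompatible T` (Cor 5.5 (iii), last sentence, typed for the cores).
[cite: MochizukiAbsTopIII2015, Cor 5.5 (iii) p. 131] -/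
theorem cor55ObservablesCompatible_diamond (T : L.TSHomotopies) (h : L.Cor55ObservablesCompatible T) (v : Vmod)
    {νa νb νc νd : LogVertex (isArc v)} (ha : νa.isPostLog = false) (hb : νb.isPostLog = false)
    (hc : νc.isPostLog = false) (hd : νd.isPostLog = false) (ε₁ : LogEdgeTS (isArc v) νa νb)
    (ε₂ : LogEdgeTS (isArc v) νb νd) (ε₃ : LogEdgeTS (isArc v) νa νc) (ε₄ : LogEdgeTS (isArc v) νc νd) (X₀ : L.X) :
    (T.iota v ε₁).app X₀ ≫ eqToHom (L.lam_forget_obj_eq_twist_obj v hb X₀) ≫ (T.iota v ε₂).app X₀ =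
      (T.iota v ε₃).app X₀ ≫ eqToHom (L.lam_forget_obj_eq_twist_obj v hc X₀) ≫ (T.iota v ε₄).app X₀ := by
  obtain ⟨K, -, hobs⟩ := h
  obtain ⟨H, hH, -⟩ := hobs v
  exact T.iota_diamond_of_isLogObservableTS v hH ha hb hc hd ε₁ ε₂ ε₃ ε₄ X₀

/-- The `TS`-diamond law under `Cor55ObservablesTelecoreCompatible T` (F-3757: Cor 5.5 (iii), last sentence, with the
telecore `𝔗_{An•}`), through `cor55ObservablesTS_of_telecoreCompatible`. [cite: MochizukiAbsTopIII2015, Cor 5.5 (iii) p. 131] -/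
theorem cor55ObservablesTelecoreCompatible_diamond (T : L.TSHomotopies) (h : L.Cor55ObservablesTelecoreCompatible T)
    (v : Vmod) {νa νb νc νd : LogVertex (isArc v)} (ha : νa.isPostLog = false) (hb : νb.isPostLog = false)
    (hc : νc.isPostLog = false) (hd : νd.isPostLog = false) (ε₁ : LogEdgeTS (isArc v) νa νb)
    (ε₂ : LogEdgeTS (isArc v) νb νd) (ε₃ : LogEdgeTS (isArc v) νa νc) (ε₄ : LogEdgeTS (isArc v) νc νd) (X₀ : L.X) :
    (T.iota v ε₁).app X₀ ≫ eqToHom (L.lam_forget_obj_eq_twist_obj v hb X₀) ≫ (T.iota v ε₂).app X₀ =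
      (T.iota v ε₃).app X₀ ≫ eqToHom (L.lam_forget_obj_eq_twist_obj v hc X₀) ≫ (T.iota v ε₄).app X₀ :=
  L.cor55ObservablesTS_diamond T (L.cor55ObservablesTS_of_telecoreCompatible T h) v ha hb hc hd ε₁ ε₂ ε₃ ε₄ X₀

/-- The `TS`-diamond of the full graph `Γ⃗^log_non` at a Boolean `b = false` (`νa = 𝒪^×_k̄`, `νb = k̄^×`,
`νc = k~` the shell-arrow's target, `νd = (k̄^×)^pf`; arrows `𝒪^× ↪ k̄^×`, `k̄^× → (k̄^×)^pf`, `𝒪^× →(log) k~`,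
`k~ ↪ (k̄^×)^pf` as edges of `Γ⃗^log_v` = index set of the `TS`-valued `ι_{v,ε}`; cf. abc-iut-f-101's
`exists_iotaSquare_of_eq_false` for the `⊞`-carrying sub-graph).  Stated for a Boolean `b = false` so that it applies to
`b := isArc v` without transport.
[cite: MochizukiAbsTopIII2015, Def 5.4 (iii) p. 126] -/
theorem exists_diamondTS_of_eq_false (b : Bool) (hb : b = false) :
    ∃ (νa νb νc νd : LogVertex b) (_ : νa.isPostLog = false) (_ : νb.isPostLog = false) (_ : νc.isPostLog = false)
      (_ : νd.isPostLog = false),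
      Nonempty (LogEdgeTS b νa νb) ∧ Nonempty (LogEdgeTS b νb νd) ∧ Nonempty (LogEdgeTS b νa νc) ∧
        Nonempty (LogEdgeTS b νc νd) := by
  subst hb
  exact ⟨NonarchVertex.units, NonarchVertex.mult, NonarchVertex.shellCod, NonarchVertex.perf, rfl, rfl, rfl, rfl,
    ⟨NonarchEdge.unitsToMult⟩, ⟨NonarchEdge.multToPerf⟩, ⟨NonarchEdge.shell⟩, ⟨NonarchEdge.shellCodToPerf⟩⟩

/-- **Criterion (`TS`-half)**: `ι_{v,ε}` violating the diamond law at one place, one diamond, one object refute the typed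
`Cor55ObservablesTS T`. [cite: MochizukiAbsTopIII2015, Cor 5.5 (iii) p. 131] -/
theorem not_cor55ObservablesTS_of_diamond_ne (T : L.TSHomotopies) (v : Vmod) {νa νb νc νd : LogVertex (isArc v)}
    (ha : νa.isPostLog = false) (hb : νb.isPostLog = false) (hc : νc.isPostLog = false) (hd : νd.isPostLog = false)
    (ε₁ : LogEdgeTS (isArc v) νa νb) (ε₂ : LogEdgeTS (isArc v) νb νd) (ε₃ : LogEdgeTS (isArc v) νa νc)
    (ε₄ : LogEdgeTS (isArc v) νc νd) (X₀ : L.X)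
    (hne : (T.iota v ε₁).app X₀ ≫ eqToHom (L.lam_forget_obj_eq_twist_obj v hb X₀) ≫ (T.iota v ε₂).app X₀ ≠
      (T.iota v ε₃).app X₀ ≫ eqToHom (L.lam_forget_obj_eq_twist_obj v hc X₀) ≫ (T.iota v ε₄).app X₀) :
    ¬ L.Cor55ObservablesTS T := fun h =>
  hne (L.cor55ObservablesTS_diamond T h v ha hb hc hd ε₁ ε₂ ε₃ ε₄ X₀)

/-- **F-3080 at a nonarchimedean place, concretely**: under `Cor55ObservablesTS T`, at every `v₀` with `isArc v₀ = false`
the `TS`-valued `ι_{v₀,ε}` commute along the diamond `𝒪^× ⇉ (k̄^×)^pf` of `Γ⃗^log_{v₀}` at every object of `𝒳` — the law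
"Def 5.4 (iii)'s diagram commutes", pushed down to `𝒩_{v₀}`. [cite: MochizukiAbsTopIII2015, Cor 5.5 (iii) p. 131] -/
theorem cor55ObservablesTS_nonarch_diamond (T : L.TSHomotopies) (h : L.Cor55ObservablesTS T) (v₀ : Vmod)
    (hv₀ : isArc v₀ = false) :
    ∃ (νa νb νc νd : LogVertex (isArc v₀)) (_ : νa.isPostLog = false) (hb : νb.isPostLog = false)
      (hc : νc.isPostLog = false) (_ : νd.isPostLog = false) (ε₁ : LogEdgeTS (isArc v₀) νa νb)
      (ε₂ : LogEdgeTS (isArc v₀) νb νd) (ε₃ : LogEdgeTS (isArc v₀) νa νc) (ε₄ : LogEdgeTS (isArc v₀) νc νd),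
      ∀ X₀ : L.X,
        (T.iota v₀ ε₁).app X₀ ≫ eqToHom (L.lam_forget_obj_eq_twist_obj v₀ hb X₀) ≫ (T.iota v₀ ε₂).app X₀ =
          (T.iota v₀ ε₃).app X₀ ≫ eqToHom (L.lam_forget_obj_eq_twist_obj v₀ hc X₀) ≫ (T.iota v₀ ε₄).app X₀ := by
  obtain ⟨νa, νb, νc, νd, ha, hb, hc, hd, ⟨ε₁⟩, ⟨ε₂⟩, ⟨ε₃⟩, ⟨ε₄⟩⟩ := exists_diamondTS_of_eq_false (isArc v₀) hv₀
  exact ⟨νa, νb, νc, νd, ha, hb, hc, hd, ε₁, ε₂, ε₃, ε₄,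
    fun X₀ => L.cor55ObservablesTS_diamond T h v₀ ha hb hc hd ε₁ ε₂ ε₃ ε₄ X₀⟩

end LogFrobeniusSetting

end Literature.AnabelianGeometry.AbsoluteAnabelian
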